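import Mathlib
import Literature.Topology.FourManifolds.ProfiniteDetectionSumS1S2
import Summits.SmoothPoincare4.SmoothPoincare4.Theses.CongruenceShadows

/-!
# Sketch — crux-ideate `HeegaardPairFreenessDetection` (stmt-SmoothPoincare4-15157), ideator 1, round 1

First lemmas of the two idea cards, stated over existing declarations, plus the kernel-checked
COMPOSITIONS showing each card's lever concludes the crux BY NAME from its named facts.

* `FQProjective G` — every finite embedding problem for `G` is weakly solvable (the finite shadow of
  "`Ĝ` is a projective profinite group", Serre, Cohomologie galoisienne I §3.4 Prop. 16 / §5.9 Cor. 2).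
* Card `projective-retract-sieve`: `FQProjective.of_retract` (PROVED), `FQProjective.of_finiteIndex`,
  `FQProjective.subsingleton_of_finite`; named-fact shapes `KneserMilnorRetract` (Perelman-free),
  `AsphericalNotFQProjective` (goodness, Perelman+Agol inside); composition `crux_of_sieve` (PROVED
  from the two facts + the tree's Jaco–Hempel bridge, modulo the two sorried group-theory lemmas).
* Card `haken-genus-descent`: named-fact shape `HakenAlternative` (Haken's lemma in kernel form,
  Perelman-free); composition `free_of_descent` / `crux_of_descent` (PROVED by strong induction on the
  genus, modulo the same two sorried lemmas).
-/

noncomputable section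

set_option linter.dupNamespace false

namespace Summit.SmoothPoincare4.SmoothPoincare4.Cruxes.HeegaardPairFreenessDetection.Sketch

open Literature.Topology.FourManifolds Subgroup
open scoped Manifold ContDiff

/-! ## The inheritable hypothesis -/

/-- `G` is **FQ-projective**: every homomorphism to a finite group lifts through every surjection of
finite groups (all finite embedding problems are weakly solvable). -/
def FQProjective (G : Type*) [Group G] : Prop :=
  ∀ (P E : Type) [Group P] [Finite P] [Group E] [Finite E] (π : G →* P) (ε : E →* P),
    Function.Surjective ε → ∃ f : G →* E, ε.comp f = π

/-- A group with exactly the finite quotients of `F_k` is FQ-projective (tree lemma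
`exists_monoidHom_comp_eq_of_sameFiniteQuotients_freeGroup`). -/
theorem fqProjective_of_sameFiniteQuotients_freeGroup {G : Type*} [Group G] {k : ℕ}
    (hQ : ∀ (Q : Type) [Group Q] [Finite Q],
      (∃ f : G →* Q, Function.Surjective f) ↔
        (∃ f : FreeGroup (Fin k) →* Q, Function.Surjective f)) :
    FQProjective G := fun P E _ _ _ _ π ε hε =>
  exists_monoidHom_comp_eq_of_sameFiniteQuotients_freeGroup hQ π ε hε

/-- FQ-projectivity is invariant under isomorphism. -/
theorem FQProjective.of_mulEquiv {G G' : Type*} [Group G] [Group G'] (hG : FQProjective G)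
    (e : G ≃* G') : FQProjective G' := by
  intro P E _ _ _ _ π ε hε
  obtain ⟨f, hf⟩ := hG P E (π.comp e.toMonoidHom) ε hε
  refine ⟨f.comp e.symm.toMonoidHom, MonoidHom.ext fun x => ?_⟩
  have := DFunLike.congr_fun hf (e.symm x)
  simpa using this

/-- **FIRST LEMMA of card `projective-retract-sieve` (PROVED): FQ-projectivity passes to retracts.**
If `r ∘ s = id_A` then every finite embedding problem for `A` is one for `G` (compose with `r`),
and a weak solution for `G` restricts along `s` to one for `A`. -/
theorem FQProjective.of_retract {G A : Type*} [Group G] [Group A] (r : G →* A) (s : A →* G)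
    (hrs : ∀ a, r (s a) = a) (hG : FQProjective G) : FQProjective A := by
  intro P E _ _ _ _ π ε hε
  obtain ⟨f, hf⟩ := hG P E (π.comp r) ε hε
  refine ⟨f.comp s, MonoidHom.ext fun a => ?_⟩
  have := DFunLike.congr_fun hf (s a)
  simpa [hrs] using this

/-- FQ-projectivity passes to finite-index subgroups (finite shadow of "closed subgroups of
projective profinite groups are projective"; proof plan: induce `V → P` to `G → P ≀ Sym(G/V)`,
lift there, read off the coordinate fixed by `V`). -/
theorem FQProjective.of_finiteIndex {G : Type*} [Group G] (hG : FQProjective G)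
    (V : Subgroup G) [V.FiniteIndex] : FQProjective V := by
  sorry

/-- No non-trivial finite group is FQ-projective (finite shadow of "projective ⇒ torsion-free"):
for `g` of prime order `p`, `⟨g⟩` is FQ-projective (`of_finiteIndex`), and `⟨g⟩ ≅ ℤ/p` does not lift
through `ℤ/p² ↠ ℤ/p`. -/
theorem FQProjective.subsingleton_of_finite {A : Type*} [Group A] [Finite A] (hA : FQProjective A) :
    Subsingleton A := by
  sorry

/-! ## Named-fact shapes (the honest fact debt of the two cards) -/

/-- `Y` (with base point `y`) is aspherical: `π_n(Y, y) = 0` for `n ≥ 2`. -/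
def IsAspherical (Y : Type*) [TopologicalSpace Y] (y : Y) : Prop :=
  ∀ n : ℕ, 2 ≤ n → Subsingleton (HomotopyGroup (Fin n) Y y)

/-- **F2 (GOOD ⇒ not projective).** The fundamental group of a closed orientable aspherical smooth
3-manifold is not FQ-projective.  In print: `π₁` is good (Aschenbrenner–Friedl–Wilton, *3-Manifold
Groups*, (G.good) via Cavendish 2012 / Wilton–Zalesskii 2010 / Agol 2013), so
`H³(π̂₁; ℤ/2) ≅ H³(Y; ℤ/2) = ℤ/2` (loc. cit. proof of Prop. 9.29), so `cd₂(π̂₁) ≥ 3`, so by Serre,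
*Cohomologie galoisienne* I §3.4 Prop. 16 ((ii) ⇒ (i)) some FINITE embedding problem with
elementary-abelian 2-group kernel has no weak solution.  Perelman + Agol–Wise inside. -/
def AsphericalNotFQProjective : Prop :=
  ∀ (Y : Type) [TopologicalSpace Y] [T2Space Y] [SecondCountableTopology Y]
    [ChartedSpace (EuclideanSpace ℝ (Fin 3)) Y] [IsManifold (𝓡 3) ∞ Y] [CompactSpace Y]
    [ConnectedSpace Y] (_ : IsOrientable (𝓡 3) Y) (y : Y),
    IsAspherical Y y → ¬ FQProjective (FundamentalGroup Y y)

/-- **F1 (Kneser–Milnor, retract form; Perelman-free).** The fundamental group of a closed orientable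
3-manifold is either free of some rank, or retracts onto a non-trivial group that is finite or is the
fundamental group of a closed orientable aspherical 3-manifold.  In print: Kneser–Milnor
(AFW Thm. 1.1, Hempel Thm. 3.15: `π₁Y = π₁Y₁ ∗ ⋯ ∗ π₁Y_r`, prime `Yᵢ`); a prime `Yᵢ` is `S¹ × S²` or
irreducible (AFW §1.1); irreducible with infinite `π₁` is aspherical (AFW (C.1): Sphere Theorem +
Hurewicz); a free factor is a retract. -/
def KneserMilnorRetract : Prop :=
  ∀ (Y : Type) [TopologicalSpace Y] [T2Space Y] [SecondCountableTopology Y]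
    [ChartedSpace (EuclideanSpace ℝ (Fin 3)) Y] [IsManifold (𝓡 3) ∞ Y] [CompactSpace Y]
    [ConnectedSpace Y] (_ : IsOrientable (𝓡 3) Y) (y : Y),
    (∃ r : ℕ, IsFreeOfRank (FundamentalGroup Y y) r) ∨
    ∃ (B : Type) (_ : Group B), Nontrivial B ∧
      (Finite B ∨
        ∃ (Z : Type) (_ : TopologicalSpace Z) (_ : T2Space Z) (_ : SecondCountableTopology Z)
          (_ : ChartedSpace (EuclideanSpace ℝ (Fin 3)) Z) (_ : IsManifold (𝓡 3) ∞ Z)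
          (_ : CompactSpace Z) (_ : ConnectedSpace Z) (_ : IsOrientable (𝓡 3) Z) (z : Z),
          IsAspherical Z z ∧ Nonempty (B ≃* FundamentalGroup Z z)) ∧
      ∃ (r : FundamentalGroup Y y →* B) (s : B →* FundamentalGroup Y y), ∀ b, r (s b) = b

/-! ## Card `projective-retract-sieve`: the composition (kill every Kneser–Milnor factor) -/

/-- **The sieve concludes the crux BY NAME** from F1, F2 and the tree's Jaco–Hempel bridge
`exists_closedThreeManifold_fundamentalGroup_pairQuotient` (modulo the two sorried group-theory
lemmas above): the pair quotient is `π₁Y`; it is FQ-projective; a finite non-trivial retract is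
impossible (`subsingleton_of_finite`), an aspherical retract is impossible (F2); so `π₁Y` is free
of some rank, and rank detection (`IsFreeOfRank.of_sameFiniteQuotients`, tree) pins the rank. -/
theorem crux_of_sieve (h₁ : KneserMilnorRetract) (h₂ : AsphericalNotFQProjective)
    (h₃ : exists_closedThreeManifold_fundamentalGroup_pairQuotient.{0}) :
    Summit.SmoothPoincare4.SmoothPoincare4.Theses.CongruenceShadows.HeegaardPairFreenessDetection := by
  intro g k K₁ K₂ hK₁ hK₂ hQ
  obtain ⟨Y, _, _, _, _, _, _, _, hY, y, ⟨e⟩⟩ := h₃ g K₁ K₂ hK₁ hK₂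
  have hQ' : ∀ (Q : Type) [Group Q] [Finite Q],
      (∃ f : FundamentalGroup Y y →* Q, Function.Surjective f) ↔
        (∃ f : FreeGroup (Fin k) →* Q, Function.Surjective f) := fun Q _ _ =>
    (exists_surjective_monoidHom_iff_of_mulEquiv e).trans (hQ Q)
  have hproj : FQProjective (FundamentalGroup Y y) :=
    fqProjective_of_sameFiniteQuotients_freeGroup hQ'
  rcases h₁ Y hY y with ⟨r, hr⟩ | ⟨B, _, hB, hkind, r, s, hrs⟩
  · exact (hr.of_sameFiniteQuotients hQ').of_mulEquiv e
  · exfalso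
    have hBproj : FQProjective B := hproj.of_retract r s hrs
    rcases hkind with hfin | ⟨Z, _, _, _, _, _, _, _, hZ, z, hasph, ⟨eB⟩⟩
    · haveI := hfin
      haveI := hBproj.subsingleton_of_finite
      exact not_nontrivial B hB
    · exact h₂ Z hZ z hasph (hBproj.of_mulEquiv eB)

/-! ## Card `haken-genus-descent`: Haken's lemma makes the Heegaard genus a descent parameter -/

/-- The pair quotient `S_g ⧸ ⟪K₁ ∪ K₂⟫`. -/
abbrev PQ (g : ℕ) (K₁ K₂ : Subgroup (SurfaceGroup g)) : Type :=
  SurfaceGroup g ⧸ normalClosure ((K₁ : Set (SurfaceGroup g)) ∪ K₂)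

/-- `K` is a handlebody kernel: `S_g ⧸ ⟪K⟫ ≅ F_g` (Leininger–Reid Lemma 2.2). -/
abbrev IsHandlebodyKernel (g : ℕ) (K : Subgroup (SurfaceGroup g)) : Prop :=
  IsFreeOfRank (SurfaceGroup g ⧸ normalClosure (K : Set (SurfaceGroup g))) g

/-- **H (Haken's alternative in kernel form; Perelman-free) — FIRST LEMMA of card
`haken-genus-descent`.**  For a Heegaard pair `(K₁, K₂)` of genus `g` with pair quotient
`G = π₁(H₁ ∪ H₂)`: EITHER `G` is finite, OR `G ≅ π₁` of a closed orientable aspherical 3-manifold,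
OR the pair is a connected sum — `G ≅ G₁ ∗ G₂` for Heegaard pairs of genera `g₁ + g₂ = g`,
`gᵢ ≥ 1` — OR it has an `S¹ × S²` summand — `G ≅ G' ∗ F₁` for a Heegaard pair of genus `g - 1`.
In print: if the splitting is reducible (an essential curve of `Σ_g` bounds discs on both sides),
reduce along the sphere (Scharlemann, arXiv:math/0007144 §3.2; Schultens GSM 151 Def. 6.3.3):
separating ⇒ connected sum of two splittings of smaller positive genera (van Kampen), non-separating
⇒ `Y = Y' # S¹×S²` with a genus-`(g-1)` splitting of `Y'` (Hempel Lemma 3.8/3.16); if the splitting is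
irreducible then `Y` is irreducible (HAKEN'S LEMMA: Schultens Thm. 6.3.5 = Scharlemann Thm. 3.4,
contrapositive), hence `π₁Y` is finite or `Y` is aspherical (AFW (C.1)). -/
def HakenAlternative : Prop :=
  ∀ (g : ℕ) (K₁ K₂ : Subgroup (SurfaceGroup g)),
    IsHandlebodyKernel g K₁ → IsHandlebodyKernel g K₂ →
    Finite (PQ g K₁ K₂) ∨
    (∃ (Z : Type) (_ : TopologicalSpace Z) (_ : T2Space Z) (_ : SecondCountableTopology Z)
        (_ : ChartedSpace (EuclideanSpace ℝ (Fin 3)) Z) (_ : IsManifold (𝓡 3) ∞ Z)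
        (_ : CompactSpace Z) (_ : ConnectedSpace Z) (_ : IsOrientable (𝓡 3) Z) (z : Z),
        IsAspherical Z z ∧ Nonempty (PQ g K₁ K₂ ≃* FundamentalGroup Z z)) ∨
    (∃ (g₁ g₂ : ℕ) (L₁ L₂ : Subgroup (SurfaceGroup g₁)) (M₁ M₂ : Subgroup (SurfaceGroup g₂)),
        g₁ + g₂ = g ∧ 0 < g₁ ∧ 0 < g₂ ∧
        IsHandlebodyKernel g₁ L₁ ∧ IsHandlebodyKernel g₁ L₂ ∧
        IsHandlebodyKernel g₂ M₁ ∧ IsHandlebodyKernel g₂ M₂ ∧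
        Nonempty (PQ g K₁ K₂ ≃* Monoid.Coprod (PQ g₁ L₁ L₂) (PQ g₂ M₁ M₂))) ∨
    (∃ (g' : ℕ) (L₁ L₂ : Subgroup (SurfaceGroup g')),
        g = g' + 1 ∧ IsHandlebodyKernel g' L₁ ∧ IsHandlebodyKernel g' L₂ ∧
        Nonempty (PQ g K₁ K₂ ≃* Monoid.Coprod (PQ g' L₁ L₂) (FreeGroup (Fin 1))))

/-- **Genus descent (PROVED modulo the two sorried lemmas): every FQ-projective Heegaard pair
quotient is free of some rank.**  Strong induction on `g` through `HakenAlternative`: finite ⇒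
trivial ⇒ free of rank `0`; aspherical ⇒ contradicts F2; `G₁ ∗ G₂` / `G' ∗ F₁` ⇒ the factors are
retracts, hence FQ-projective, hence free by induction, hence `G` is free (`IsFreeOfRank.coprod`). -/
theorem free_of_descent (hH : HakenAlternative) (h₂ : AsphericalNotFQProjective) :
    ∀ (g : ℕ) (K₁ K₂ : Subgroup (SurfaceGroup g)),
      IsHandlebodyKernel g K₁ → IsHandlebodyKernel g K₂ →
      FQProjective (PQ g K₁ K₂) → ∃ r : ℕ, IsFreeOfRank (PQ g K₁ K₂) r := by
  intro g
  induction g using Nat.strong_induction_on with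
  | _ g ih =>
    intro K₁ K₂ hK₁ hK₂ hproj
    rcases hH g K₁ K₂ hK₁ hK₂ with hfin | ⟨Z, _, _, _, _, _, _, _, hZ, z, hasph, ⟨eZ⟩⟩ |
        ⟨g₁, g₂, L₁, L₂, M₁, M₂, hg, hg₁, hg₂, hL₁, hL₂, hM₁, hM₂, ⟨e⟩⟩ | ⟨g', L₁, L₂, hg, hL₁, hL₂, ⟨e⟩⟩
    · haveI := hfin
      haveI := hproj.subsingleton_of_finite
      exact ⟨0, isFreeOfRank_zero_of_subsingleton _⟩
    · exact absurd (hproj.of_mulEquiv eZ) (h₂ Z hZ z hasph)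
    · have hP : FQProjective (Monoid.Coprod (PQ g₁ L₁ L₂) (PQ g₂ M₁ M₂)) := hproj.of_mulEquiv e
      have h1 : FQProjective (PQ g₁ L₁ L₂) :=
        hP.of_retract (Monoid.Coprod.fst : _ →* PQ g₁ L₁ L₂) Monoid.Coprod.inl
          (fun a => Monoid.Coprod.fst_apply_inl a)
      have h2 : FQProjective (PQ g₂ M₁ M₂) :=
        hP.of_retract (Monoid.Coprod.snd : _ →* PQ g₂ M₁ M₂) Monoid.Coprod.inr
          (fun a => Monoid.Coprod.snd_apply_inr a)
      obtain ⟨r₁, hr₁⟩ := ih g₁ (by omega) L₁ L₂ hL₁ hL₂ h1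
      obtain ⟨r₂, hr₂⟩ := ih g₂ (by omega) M₁ M₂ hM₁ hM₂ h2
      exact ⟨r₁ + r₂, (hr₁.coprod hr₂).of_mulEquiv e.symm⟩
    · have hP : FQProjective (Monoid.Coprod (PQ g' L₁ L₂) (FreeGroup (Fin 1))) := hproj.of_mulEquiv e
      have h1 : FQProjective (PQ g' L₁ L₂) :=
        hP.of_retract (Monoid.Coprod.fst : _ →* PQ g' L₁ L₂) Monoid.Coprod.inl
          (fun a => Monoid.Coprod.fst_apply_inl a)
      obtain ⟨r₁, hr₁⟩ := ih g' (by omega) L₁ L₂ hL₁ hL₂ h1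
      have hF : IsFreeOfRank (FreeGroup (Fin 1)) 1 := ⟨MulEquiv.refl _⟩
      exact ⟨r₁ + 1, (hr₁.coprod hF).of_mulEquiv e.symm⟩

/-- **The descent concludes the crux BY NAME** from H and F2 alone (no Kneser–Milnor, no Grushko, no
profinite Bass–Serre, no realisation fact beyond what H packages): FQ-projectivity from the
hypothesis, freeness of some rank by `free_of_descent`, the rank by rank detection (tree). -/
theorem crux_of_descent (hH : HakenAlternative) (h₂ : AsphericalNotFQProjective) :
    Summit.SmoothPoincare4.SmoothPoincare4.Theses.CongruenceShadows.HeegaardPairFreenessDetection := by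
  intro g k K₁ K₂ hK₁ hK₂ hQ
  obtain ⟨r, hr⟩ := free_of_descent hH h₂ g K₁ K₂ hK₁ hK₂
    (fqProjective_of_sameFiniteQuotients_freeGroup hQ)
  exact hr.of_sameFiniteQuotients hQ

/-! ## Barrier note (Perelman is necessary): the `k = 0` instance of the crux -/

/-- The `k = 0` instance of the crux says: a Heegaard pair quotient with NO non-trivial finite
quotient is trivial — "profinitely trivial closed 3-manifold groups are trivial", a statement open
before geometrization (aspherical integral homology spheres).  Recorded to show no Perelman-free
line can exist; stated here, trivially, as crux ⇒ its `k = 0` case. -/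
theorem profinitelyTrivial_pairQuotient_trivial
    (h : Summit.SmoothPoincare4.SmoothPoincare4.Theses.CongruenceShadows.HeegaardPairFreenessDetection)
    (g : ℕ) (K₁ K₂ : Subgroup (SurfaceGroup g)) (hK₁ : IsHandlebodyKernel g K₁)
    (hK₂ : IsHandlebodyKernel g K₂)
    (hno : ∀ (Q : Type) [Group Q] [Finite Q] (f : PQ g K₁ K₂ →* Q), Function.Surjective f →
      Subsingleton Q) :
    Subsingleton (PQ g K₁ K₂) := by
  have hQ : ∀ (Q : Type) [Group Q] [Finite Q],
      (∃ f : PQ g K₁ K₂ →* Q, Function.Surjective f) ↔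
        (∃ f : FreeGroup (Fin 0) →* Q, Function.Surjective f) := by
    intro Q _ _
    constructor
    · rintro ⟨f, hf⟩
      haveI := hno Q f hf
      exact ⟨1, fun q => ⟨1, Subsingleton.elim _ _⟩⟩
    · rintro ⟨f, hf⟩
      haveI : Subsingleton Q := by
        refine ⟨fun a b => ?_⟩
        obtain ⟨x, rfl⟩ := hf a
        obtain ⟨y, rfl⟩ := hf b
        haveI : IsEmpty (Fin 0) := inferInstance
        have hx : x = 1 := by
          induction x using FreeGroup.induction_on with
          | C1 => rfl
          | of i => exact isEmptyElim i
          | inv_of i _ => exact isEmptyElim i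
          | mul x y hx hy => rw [hx, hy, mul_one]
        have hy : y = 1 := by
          induction y using FreeGroup.induction_on with
          | C1 => rfl
          | of i => exact isEmptyElim i
          | inv_of i _ => exact isEmptyElim i
          | mul x y hx hy => rw [hx, hy, mul_one]
        rw [hx, hy]
      exact ⟨1, fun q => ⟨1, Subsingleton.elim _ _⟩⟩
  obtain ⟨e⟩ := h g 0 K₁ K₂ hK₁ hK₂ hQ
  haveI : IsEmpty (Fin 0) := inferInstance
  haveI : Subsingleton (FreeGroup (Fin 0)) := by
    refine ⟨fun x y => ?_⟩
    have hx : ∀ x : FreeGroup (Fin 0), x = 1 := fun x => by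
      induction x using FreeGroup.induction_on with
      | C1 => rfl
      | of i => exact isEmptyElim i
      | inv_of i _ => exact isEmptyElim i
      | mul x y hx hy => rw [hx, hy, mul_one]
    rw [hx x, hx y]
  exact e.symm.injective.subsingleton

end Summit.SmoothPoincare4.SmoothPoincare4.Cruxes.HeegaardPairFreenessDetection.Sketch

end
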